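import Summits.RiemannHypothesis.RiemannHypothesis.Theses.WeilSemilocal
import HarnessLib

/-!
# Route `WeilSemilocal` — the GLUE support item `WallsSixtyKGapSplit` (pure logic, RH-FREE)

Item stmt-RiemannHypothesis-19187 of `route-RiemannHypothesis-WeilSemilocal` (rev 4–6, planner weil-routes-1): the
layer-2 split of the crux `SemilocalWallsToSixtyThousand` (C-I(a) at every prime `10⁴ ≤ q < 6·10⁴`) BY GAP CLASS —
`WallsSixtyKTwin` (the lower twins, `(q+2).Prime`, tier 2) and `WallsSixtyKNonTwin` (gap `≥ 4`, `¬ (q+2).Prime`, tier 1) —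
recombines to the parent by excluded middle on `(q + 2).Prime`.  One-line closer; no tree theorem used.  Nothing here
bears on the truth of RH (UPPER clauses of truncated Weil forms only; cell `rh-explicit`, typing lane cc-s2-1 gen21).
-/

set_option linter.dupNamespace false  -- the mandated namespace repeats `RiemannHypothesis`

namespace Summit.RiemannHypothesis.RiemannHypothesis.Theorems.WeilSemilocalRoute

open Summit.RiemannHypothesis.RiemannHypothesis.Theses.WeilSemilocal

/-- **GLUE `WallsSixtyKGapSplit`** (item stmt-RiemannHypothesis-19187): `WallsSixtyKTwin → WallsSixtyKNonTwin →
SemilocalWallsToSixtyThousand`, by cases on `(q + 2).Prime`. [this cell; pure logic] -/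
theorem wallsSixtyKGapSplit_proof :
    Summit.RiemannHypothesis.RiemannHypothesis.Theses.WeilSemilocal.WallsSixtyKGapSplit := by
  unfold Theses.WeilSemilocal.WallsSixtyKGapSplit
  intro hT hN
  unfold Theses.WeilSemilocal.WallsSixtyKTwin at hT
  unfold Theses.WeilSemilocal.WallsSixtyKNonTwin at hN
  unfold Theses.WeilSemilocal.SemilocalWallsToSixtyThousand
  intro q hq hlo hhi
  by_cases h2 : (q + 2).Prime
  · exact hT q hq hlo hhi h2
  · exact hN q hq hlo hhi h2

end Summit.RiemannHypothesis.RiemannHypothesis.Theorems.WeilSemilocalRoute
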